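import Summits.Ventures.PercRepro.MSTightTwoFamily
import Summits.Ventures.PercRepro.MSTightTighteningSplit

/-!
# The differences of a half that are differences against the partner family

Dossier proofs/MINE1-theoremS.md, Addendum 50 §3. At a tightening direction `r` of an excess-one
family `F` (`|D(F)| = |F| + 1`, `proj r F` tight) the two-family inequality of `MSTightTwoFamily`
in the instance `B = F₁`, `A = K`, `C = F₀` reads `|F₁| ≤ |F₁ \\ K| + |D(F₁) ∖ (F₀ \\ K)|`, and
`F₁ \\ K ⊆ X ∩ Y` has at most `|K| + 1` elements; hence
**`|D(F₁) ∩ (F₀ \\ K)| ≤ |K| + 1 + exc(F₁)`** (`card_diffs_partr_inter_part0_diffs_partner_le`),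
and by the mirror instance **`|D(F₀) ∩ (K \\ F₁)| ≤ |K| + 1 + exc(F₀)`**
(`card_diffs_part0_inter_partner_diffs_partr_le`). Since `K \\ K` lies in both intersections, in
case (β) of the tightening split (`|K \\ K| = |K| + 1`) a TIGHT half leaves no room:
`D(F₁) ∩ (F₀ \\ K) = K \\ K` when `F₁` is tight (`diffs_partr_inter_eq_of_tight_partr`) and
`D(F₀) ∩ (K \\ F₁) = K \\ K` when `F₀` is tight (`diffs_part0_inter_eq_of_tight_part0`); a half
of excess one admits at most one exception. In words: a difference `s ∖ k` of a partnerless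
`r`-free member against a partner member that is also a difference of the tight `r`-half is a
difference of the partner family — the bookkeeping behind the lane's (M0) analysis.
-/

namespace PercRepro.MSTight

open Finset
open scoped FinsetFamily

variable {α : Type*} [DecidableEq α] {r : α} {F : Finset (Finset α)}

section Tightening

variable (hF : (F \\ F).card = F.card + 1) (hP : Tight (proj r F))
include hF hP

/-- `|F₁ \\ K| ≤ |K| + 1` at a tightening direction of an excess-one family. -/
theorem card_partr_diffs_partner_le : (partr r F \\ partner r F).card ≤ (partner r F).card + 1 := by
  have h := card_le_card (partr_diffs_partner_subset (r := r) (F := F))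
  have hXY := (tight_proj_iff_card_edges hF r).1 hP
  omega

/-- `|K \\ F₀| ≤ |K| + 1` at a tightening direction of an excess-one family. -/
theorem card_partner_diffs_part0_le : (partner r F \\ part0 r F).card ≤ (partner r F).card + 1 := by
  have h := card_le_card (partner_diffs_part0_subset (r := r) (F := F))
  have hXY := (tight_proj_iff_card_edges hF r).1 hP
  omega

/-- **`|D(F₁) ∩ (F₀ \\ K)| + |F₁| ≤ |D(F₁)| + |K| + 1`**, i.e. the differences of the `r`-half
that are differences of `r`-free members against partner members number at most
`|K| + 1 + exc(F₁)`. -/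
theorem card_diffs_partr_inter_part0_diffs_partner_le :
    ((partr r F \\ partr r F) ∩ (part0 r F \\ partner r F)).card + (partr r F).card ≤
      (partr r F \\ partr r F).card + (partner r F).card + 1 := by
  have h1 := card_le_card_diffs_add_card_sdiff_diffs (partner r F) (partr r F) (part0 r F)
  have h2 := card_partr_diffs_partner_le hF hP
  have h3 := card_sdiff_add_card_inter (partr r F \\ partr r F) (part0 r F \\ partner r F)
  omega

/-- **The mirror: `|D(F₀) ∩ (K \\ F₁)| + |F₀| ≤ |D(F₀)| + |K| + 1`.** -/
theorem card_diffs_part0_inter_partner_diffs_partr_le :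
    ((part0 r F \\ part0 r F) ∩ (partner r F \\ partr r F)).card + (part0 r F).card ≤
      (part0 r F \\ part0 r F).card + (partner r F).card + 1 := by
  have h1 := card_le_card_diffs_add_card_sdiff_diffs' (partner r F) (part0 r F) (partr r F)
  have h2 := card_partner_diffs_part0_le hF hP
  have h3 := card_sdiff_add_card_inter (part0 r F \\ part0 r F) (partner r F \\ partr r F)
  omega

omit hF hP in
/-- `K \\ K ⊆ D(F₁) ∩ (F₀ \\ K)`. -/
theorem diffs_partner_subset_diffs_partr_inter :
    partner r F \\ partner r F ⊆ (partr r F \\ partr r F) ∩ (part0 r F \\ partner r F) :=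
  subset_inter (diffs_subset partner_subset_partr partner_subset_partr)
    (diffs_subset partner_subset_part0 (subset_refl _))

omit hF hP in
/-- `K \\ K ⊆ D(F₀) ∩ (K \\ F₁)`. -/
theorem diffs_partner_subset_diffs_part0_inter :
    partner r F \\ partner r F ⊆ (part0 r F \\ part0 r F) ∩ (partner r F \\ partr r F) :=
  subset_inter (diffs_subset partner_subset_part0 partner_subset_part0)
    (diffs_subset (subset_refl _) partner_subset_partr)

/-- **Case (β), `F₁` tight: every difference of `F₁` that is a difference of an `r`-free member
against a partner member is a difference of the partner family.** -/
theorem diffs_partr_inter_eq_of_tight_partr (hβ : (partner r F \\ partner r F).card = (partner r F).card + 1)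
    (h1 : Tight (partr r F)) :
    (partr r F \\ partr r F) ∩ (part0 r F \\ partner r F) = partner r F \\ partner r F := by
  symm
  apply eq_of_subset_of_card_le diffs_partner_subset_diffs_partr_inter
  have h := card_diffs_partr_inter_part0_diffs_partner_le hF hP
  unfold Tight at h1
  omega

/-- **Case (β), `F₀` tight: the mirror.** -/
theorem diffs_part0_inter_eq_of_tight_part0 (hβ : (partner r F \\ partner r F).card = (partner r F).card + 1)
    (h0 : Tight (part0 r F)) :
    (part0 r F \\ part0 r F) ∩ (partner r F \\ partr r F) = partner r F \\ partner r F := by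
  symm
  apply eq_of_subset_of_card_le diffs_partner_subset_diffs_part0_inter
  have h := card_diffs_part0_inter_partner_diffs_partr_le hF hP
  unfold Tight at h0
  omega

end Tightening

end PercRepro.MSTight
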